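import Summits.ResolutionOfSingularities.ResolutionOfSingularities.Theorems.PurelyInseparableDim4Perm2BoundTranslated
import HarnessLib

/-!
# [OURS · res-dim4-pi PR-2, part 6b] Finer translated bounds by Hasse probes: `d′ + g ≤ 2d + min(p^k, r_{i₀})`
  and the `ℓ`-form `d′ + g ≤ 2d + p^ℓ`; what the maximal excess `+p^{e−1}` needs

Cell `res-dim4-pi` (D-0157 DOOR 2), lineage **PR-2** (seat `res-dim4-p-2`, generation 3), part 6b (sequel of
`…Perm2BoundAttained`, part 6a; notation as there: state `(F, r, exc)`, `o = ord₀ F`, `d = o − |r|`, centre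
`V(z, x_S)` under condition (1) only, chart `j ∈ S`, point `b` over the origin of the centre, `g = ord_{(x_S)} F −
Σ_{i∈S} r_i`, `d′` the new shade, `q = p^e`). Part 3 bounded `d′ + g ≤ 2d + p^{e−1}` by transferring Moh's bound for
the point blow-up; the tree proves Moh's bound by HASSE PROBES with an explicit slack
(`PointBlowup.shade_step_le_add_of_choose_ne_zero`: `d′_pt ≤ d + min(p^k, r_{i₀})` whenever an initial monomial
`x^{d₀}` of `F` has `(d₀ i₀ choose p^k) ≢ 0 (mod p)`, `i₀ ≠ j`, `k < e` — Hauser–Perlega's `ε_{i,k}`; and the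
`ℓ`-form `PointBlowup.shade_step_le_add_pow`). Transferred through part 3's `shade_step_add_le_shade_pointStep_add`:

* **`shade_step_add_le_two_mul_add_min` : `d′ + g ≤ 2d + min(p^k, r_{i₀})`** for every such probe (no cleanness
  hypothesis) — the excess over the origin bound is at most the multiplicity of any probed coordinate;
* **`shade_step_add_le_two_mul_add_pow_of_not_dvd` : `d′ + g ≤ 2d + p^ℓ`** (`ℓ < e`) as soon as the initial form of
  `F` is not a `p^{ℓ+1}`-th power (some initial exponent, at any index, not divisible by `p^{ℓ+1}`);
* **`pow_dvd_of_shade_step_add_eq_two_mul_add_pow`**: the maximal excess `d′ + g = 2d + p^{e−1}` needs EVERY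
  initial exponent of `F` divisible by `p^{e−1}`;
* **`pow_le_of_shade_step_add_eq_two_mul_add_pow`**: … and `p^{e−1} ≤ r_{i₀}` at every index `i₀ ≠ j` carrying an
  initial exponent not divisible by `p^e`, whose `p`-adic digit profile is then `(0,…,0,≠0)` below `e`
  (with part 4's `necessary_of_two_mul_lt` (ii) such an `i₀` is a LOST coordinate of the centre; part 5's family,
  `q = p^{e+1}`, `r = (0, n, 0, pᵉ)`, `x₄` lost, is the boundary case `r_{i₀} = p^{(e+1)−1}`).

[OURS · counted 0 · AI work weaker than expert review] NOTHING here proves resolution of singularities in dimension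
≥ 4 / characteristic `p`: bookkeeping of the letter `d` of OUR candidate frame (MODE 1h coordinate game); census
value (at `e ≥ 2` the translated excess population is graded by the smallest probed lost multiplicity).
bears_on: LADDER-RESOLUTION:D157-DOOR2 (res-dim4-pi · PR-2). Supports stmt-ResolutionOfSingularities-16155 (helper).
-/

noncomputable section

set_option linter.dupNamespace false -- mandated namespace of this single-conjunct summit
open MvPolynomial Finset
open scoped BigOperators

namespace Summit.ResolutionOfSingularities.ResolutionOfSingularities.Theorems.PIDim4
namespace Perm2Bound
open Literature.AlgebraicGeometry.Resolution
open Literature.AlgebraicGeometry.Resolution.CentreBlowup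
open Literature.AlgebraicGeometry.Resolution.Hauser2010

section Probes

variable {σ : Type*} {K : Type*} [Field K] [Fintype σ] [DecidableEq σ] [DecidableEq K]
variable (p : ℕ) [hp : Fact p.Prime] [CharP K p]

/-- **`d′ + g ≤ 2d + min(p^k, r_{i₀})` for every Hasse probe** (`q = p^e`; NO cleanness needed): if an initial
monomial `x^{d₀}` of `F` has `(d₀ i₀ choose p^k) ≢ 0 (mod p)` at an index `i₀ ≠ j`, for some `k < e`, then the
excess over the origin bound `2d − g` is at most `min(p^k, r_{i₀})` — the transfer of the tree's quantitative
probe `PointBlowup.shade_step_le_add_of_choose_ne_zero` (Hauser–Perlega's slack `ε_{i,k} = p^k` at an exceptional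
index, truncated by `r_{i₀}`). At a kept (`b_{i₀} = 0`) or non-exceptional (`r_{i₀} = 0`) index part 4
(`necessary_of_two_mul_lt` (ii)) already gives `≤ 2d`. [cite: HauserPerlega2019PRIMS, §5 (proof of the Theorem, assertion (9))] -/
theorem shade_step_add_le_two_mul_add_min {e : ℕ} {S : Finset σ} {j : σ} (hj : j ∈ S)
    (b : σ → K) (hbj : b j = 0) (hbN : ∀ i, i ∉ S → b i = 0) (s : CState σ K) {o : ℕ}
    (ho : ordZero s.F = o) (hr : ∀ d ∈ s.F.support, s.r ≤ d)
    (hq : ∀ d ∈ s.F.support, p ^ e ≤ degIn S d) {g : ℕ}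
    (hg : ordAlong S s.F = ((degIn S s.r + g : ℕ) : ℕ∞)) {i₀ : σ} (hi₀ : i₀ ≠ j) {k : ℕ}
    (hk : k < e) {d₀ : σ →₀ ℕ} (hd₀ : d₀ ∈ s.F.support) (hd₀deg : d₀.degree = o)
    (hd₀i : ((d₀ i₀).choose (p ^ k) : K) ≠ 0) :
    (step (p ^ e) S j b s).shade + (g : ℕ∞) ≤ 2 * s.shade + ((min (p ^ k) (s.r i₀) : ℕ) : ℕ∞) := by
  have hT := shade_step_add_le_shade_pointStep_add hj b hbj hbN s ho hr hq hg
  have hqo : p ^ e ≤ o := by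
    have k1 := hq d₀ hd₀
    have k2 := degIn_le_degree S d₀
    omega
  have hP := PointBlowup.shade_step_le_add_of_choose_ne_zero p j b hbj s.toState ho hqo hr hi₀ hk hd₀
    hd₀deg hd₀i
  have hs : s.toState.shade = s.shade := rfl
  have hsr : s.toState.r = s.r := rfl
  rw [hs, hsr] at hP
  calc (step (p ^ e) S j b s).shade + (g : ℕ∞)
      ≤ (PointBlowup.step (p ^ e) j b s.toState).shade + s.shade := hT
    _ ≤ (s.shade + ((min (p ^ k) (s.r i₀) : ℕ) : ℕ∞)) + s.shade := add_le_add hP le_rfl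
    _ = 2 * s.shade + ((min (p ^ k) (s.r i₀) : ℕ) : ℕ∞) := by rw [two_mul]; abel

/-- **The `ℓ`-form: `d′ + g ≤ 2d + p^ℓ`** (`q = p^e`, `ℓ < e`) whenever the initial form of `F` is NOT a
`p^{ℓ+1}`-th power — some initial monomial has an exponent (at ANY index, `j` included) not divisible by
`p^{ℓ+1}`: the transfer of the tree's `PointBlowup.shade_step_le_add_pow` (Hauser–Perlega's
«`ord I₁′ ≤ ord I + (c!/q)·p^ℓ`», Moh's «in fact `d + pʳ`»). Part 3's `+p^{e−1}` is `ℓ = e − 1`.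
[cite: HauserPerlega2019PRIMS, §3 Theorem (9) and its proof] [cite: Moh1987, Stability Theorem ("in fact, d + p^r")] -/
theorem shade_step_add_le_two_mul_add_pow_of_not_dvd {e ℓ : ℕ} (hℓ : ℓ < e) {S : Finset σ} {j : σ}
    (hj : j ∈ S) (b : σ → K) (hbj : b j = 0) (hbN : ∀ i, i ∉ S → b i = 0) (s : CState σ K) {o : ℕ}
    (ho : ordZero s.F = o) (hr : ∀ d ∈ s.F.support, s.r ≤ d)
    (hq : ∀ d ∈ s.F.support, p ^ e ≤ degIn S d) {g : ℕ}
    (hg : ordAlong S s.F = ((degIn S s.r + g : ℕ) : ℕ∞))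
    (hinit : ∃ d₀ ∈ s.F.support, d₀.degree = o ∧ ∃ i, ¬ p ^ (ℓ + 1) ∣ d₀ i) :
    (step (p ^ e) S j b s).shade + (g : ℕ∞) ≤ 2 * s.shade + ((p ^ ℓ : ℕ) : ℕ∞) := by
  have hT := shade_step_add_le_shade_pointStep_add hj b hbj hbN s ho hr hq hg
  have hqo : p ^ e ≤ o := by
    obtain ⟨d₀, hd₀, hd₀deg, -⟩ := hinit
    have k1 := hq d₀ hd₀
    have k2 := degIn_le_degree S d₀
    omega
  have hP := PointBlowup.shade_step_le_add_pow p hℓ j b hbj s.toState ho hqo hr hinit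
  have hs : s.toState.shade = s.shade := rfl
  rw [hs] at hP
  calc (step (p ^ e) S j b s).shade + (g : ℕ∞)
      ≤ (PointBlowup.step (p ^ e) j b s.toState).shade + s.shade := hT
    _ ≤ (s.shade + ((p ^ ℓ : ℕ) : ℕ∞)) + s.shade := add_le_add hP le_rfl
    _ = 2 * s.shade + ((p ^ ℓ : ℕ) : ℕ∞) := by rw [two_mul]; abel

/-- **The maximal excess needs a `p^{e−1}`-th power initial form**: if `d′ + g = 2d + p^{e−1}` (`q = p^e`,
`e ≥ 1`) then EVERY exponent of EVERY initial monomial of `F` is divisible by `p^{e−1}` (else the `ℓ`-form with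
`ℓ = e − 2` bounds the excess by `p^{e−2} < p^{e−1}`; vacuous at `e = 1`). [cite: HauserPerlega2019PRIMS, §3 Theorem (9) and its proof] -/
theorem pow_dvd_of_shade_step_add_eq_two_mul_add_pow {e : ℕ} (he : 1 ≤ e) {S : Finset σ} {j : σ}
    (hj : j ∈ S) (b : σ → K) (hbj : b j = 0) (hbN : ∀ i, i ∉ S → b i = 0) (s : CState σ K) {o : ℕ}
    (ho : ordZero s.F = o) (hr : ∀ d ∈ s.F.support, s.r ≤ d)
    (hq : ∀ d ∈ s.F.support, p ^ e ≤ degIn S d) {g : ℕ}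
    (hg : ordAlong S s.F = ((degIn S s.r + g : ℕ) : ℕ∞))
    (heq : (step (p ^ e) S j b s).shade + (g : ℕ∞) = 2 * s.shade + ((p ^ (e - 1) : ℕ) : ℕ∞)) :
    ∀ d₀ ∈ s.F.support, d₀.degree = o → ∀ i, p ^ (e - 1) ∣ d₀ i := by
  intro d₀ hd₀ hd₀deg i
  by_contra hndvd
  -- `e ≥ 2` (at `e = 1` the divisibility is by `p⁰ = 1`)
  have he2 : 2 ≤ e := by
    by_contra hlt
    have he1 : e = 1 := by omega
    rw [he1, Nat.sub_self, pow_zero] at hndvd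
    exact hndvd (one_dvd _)
  have hℓ : e - 2 < e := by omega
  have hinit : ∃ d₀ ∈ s.F.support, d₀.degree = o ∧ ∃ i, ¬ p ^ (e - 2 + 1) ∣ d₀ i :=
    ⟨d₀, hd₀, hd₀deg, i, by rw [show e - 2 + 1 = e - 1 by omega]; exact hndvd⟩
  have hb := shade_step_add_le_two_mul_add_pow_of_not_dvd p hℓ hj b hbj hbN s ho hr hq hg hinit
  rw [heq, CState.shade_eq_of_ordZero_eq s ho] at hb
  have hb' : 2 * (o - s.r.degree) + p ^ (e - 1) ≤ 2 * (o - s.r.degree) + p ^ (e - 2) := by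
    exact_mod_cast hb
  have hlt : p ^ (e - 2) < p ^ (e - 1) := Nat.pow_lt_pow_right hp.out.one_lt (by omega)
  omega

/-- **The maximal excess needs `r_{i₀} ≥ p^{e−1}` at every probed index**: if `d′ + g = 2d + p^{e−1}`
(`q = p^e`) and an initial monomial `x^{d₀}` of `F` has an exponent `d₀ i₀`, `i₀ ≠ j`, NOT divisible by `p^e`,
then `p^{e−1} ≤ r_{i₀}` (by §3's probe at the `p`-adic valuation `k` of `d₀ i₀`: the excess is
`≤ min(p^k, r_{i₀})`); with part 4 (`necessary_of_two_mul_lt` (ii)) such an `i₀` is a LOST coordinate of the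
centre. Part 5's family (`q = p^{e+1}`, `r = (0, n, 0, pᵉ)`, `x₄` lost) is the boundary case.
[cite: HauserPerlega2019PRIMS, §3 Theorem (6), (9) and Comment (d)] -/
theorem pow_le_of_shade_step_add_eq_two_mul_add_pow {e : ℕ} {S : Finset σ} {j : σ} (hj : j ∈ S)
    (b : σ → K) (hbj : b j = 0) (hbN : ∀ i, i ∉ S → b i = 0) (s : CState σ K) {o : ℕ}
    (ho : ordZero s.F = o) (hr : ∀ d ∈ s.F.support, s.r ≤ d)
    (hq : ∀ d ∈ s.F.support, p ^ e ≤ degIn S d) {g : ℕ}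
    (hg : ordAlong S s.F = ((degIn S s.r + g : ℕ) : ℕ∞))
    (heq : (step (p ^ e) S j b s).shade + (g : ℕ∞) = 2 * s.shade + ((p ^ (e - 1) : ℕ) : ℕ∞))
    {i₀ : σ} (hi₀ : i₀ ≠ j) {d₀ : σ →₀ ℕ} (hd₀ : d₀ ∈ s.F.support) (hd₀deg : d₀.degree = o)
    (hndvd : ¬ p ^ e ∣ d₀ i₀) :
    p ^ (e - 1) ≤ s.r i₀ ∧ ((d₀ i₀).choose (p ^ (e - 1)) : K) ≠ 0 ∧
      ∀ k, k + 1 < e → ((d₀ i₀).choose (p ^ k) : K) = 0 := by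
  -- every probe `(i₀, k)` bounds the excess by `min(p^k, r_{i₀})`, which must be `≥ p^{e-1}`
  have key : ∀ k, k < e → ((d₀ i₀).choose (p ^ k) : K) ≠ 0 → p ^ (e - 1) ≤ min (p ^ k) (s.r i₀) := by
    intro k hk hk0
    have hb := shade_step_add_le_two_mul_add_min p hj b hbj hbN s ho hr hq hg hi₀ hk hd₀ hd₀deg hk0
    rw [heq, CState.shade_eq_of_ordZero_eq s ho] at hb
    have hb' : 2 * (o - s.r.degree) + p ^ (e - 1) ≤ 2 * (o - s.r.degree) + min (p ^ k) (s.r i₀) := by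
      exact_mod_cast hb
    omega
  obtain ⟨k, hk, hk0⟩ := exists_natCast_choose_prime_pow_ne_zero p K hndvd
  have hmin := key k hk hk0
  have hke : k = e - 1 := by
    by_contra hne
    have hlt : p ^ k < p ^ (e - 1) := Nat.pow_lt_pow_right hp.out.one_lt (by omega)
    have := le_trans hmin (min_le_left _ _)
    omega
  subst hke
  refine ⟨le_trans hmin (min_le_right _ _), hk0, fun k' hk' => ?_⟩
  by_contra hne
  have hmin' := key k' (by omega) hne
  have hlt : p ^ k' < p ^ (e - 1) := Nat.pow_lt_pow_right hp.out.one_lt (by omega)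
  have := le_trans hmin' (min_le_left _ _)
  omega

end Probes

end Perm2Bound

end Summit.ResolutionOfSingularities.ResolutionOfSingularities.Theorems.PIDim4

end
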